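import Literature.Probability.RandomPlanarGeometry.LoewnerThrTip
import Literature.Probability.RandomPlanarGeometry.LoewnerThrFinite
import HarnessLib

/-!
# (D) The image of the trace is the trace of the through-swallow image chain

Topic `Probability/RandomPlanarGeometry`; theorems only (crux `stmt-CriticalPhenomena-0698`, stub
`stub_isLocal` / `stub_thrTipIdentity`, item (3) = (D) of the through-swallow programme of the
locality of SLE₆: G. F. Lawler (2005), §6.3 Thm. 6.13 — `γ*(t) = Φ ∘ γ(t)` is, after the capacity
time change, the curve generating the Loewner chain of `U*`, through the instants at which the hull
swallows whole pieces of `A`; Lawler–Schramm–Werner (2003), §5). The deterministic identification of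
the conformal-image Loewner chain THROUGH the swallow instants: `thr_apply_clockC_eq_of_finite`
(`LoewnerThrTip`) with the finiteness of the remaining hulls supplied by `finite_image_remHull`
(`LoewnerThrFinite`: a packing argument, the curve avoiding the hull).
-/

noncomputable section

open Set Filter Topology Function Complex Metric
open scoped NNReal

namespace Literature.Probability.RandomPlanarGeometry

namespace Loewner

variable {W : ℝ≥0 → ℝ} {A : Set ℂ}

/-- **(D) The image of the trace is the trace of the through-swallow image chain.** Let `W` be
continuous from `0`, `A` a nonempty `*`-hull, `β₂ < β` horizons such that the remaining hull
`A ∖ K̂_t = Loewner.remHull W A t` is closed for all `t ≤ β` (clusterwise swallowing), the chain of `W`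
generated by `γ` with `γ` avoiding `A` on `[0, β]`, and the chain of a continuous `U'` equal to the
through-swallow image driver in capacity time `Loewner.thrImageDriverC W A β` up to
`Loewner.thrClockC W A β₂` generated by `γ'`. Then `γ' (thrClockC W A t) = E_A (γ t)` for every
`t ≤ β₂` (`thr_apply_clockC_eq_of_finite`, the remaining hulls being finitely many by
`finite_image_remHull`). [cite: Lawler2005, §6.3 Thm. 6.13 (γ* = Φ ∘ γ after the time change); LawlerSchrammWerner2003Restriction, §5] -/
theorem thr_apply_clockC_eq_of_isGeneratedByCurve (hW : Continuous W) (hW0 : W 0 = 0)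
    (hA : IsStarHull A) (hne : A.Nonempty) {β β₂ : ℝ≥0} (hβ₂ : β₂ < β)
    (hcl : ∀ t ≤ β, IsClosed (remHull W A t))
    {γ : ℝ≥0 → ℂ} (hγ : IsGeneratedByCurve W γ) (hγA : ∀ t ≤ β, γ t ∉ A)
    {U' : ℝ≥0 → ℝ} (hU' : Continuous U')
    (hagree : ∀ s, s ≤ thrClockC W A β₂ → U' s = thrImageDriverC W A β s)
    {γ' : ℝ≥0 → ℂ} (hγ' : IsGeneratedByCurve U' γ') (t : ℝ≥0) (ht : t ≤ β₂) :
    γ' (thrClockC W A t) = starMap A (γ t) :=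
  thr_apply_clockC_eq_of_finite hW hW0 hA hne hβ₂ hcl (finite_image_remHull hγ hW hA hcl hγA) hγ hγA hU'
    hagree hγ' t ht

end Loewner

end Literature.Probability.RandomPlanarGeometry

end
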